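import Literature.AnabelianGeometry.EtaleTheta.Discharge.Sec3ConstantLineOfRlfZ
import Literature.AnabelianGeometry.EtaleTheta.Discharge.Sec3Prop34CnstOfRlfQ
import Literature.AnabelianGeometry.EtaleTheta.Discharge.Sec3FLambdaInvOfRlf
import HarnessLib

/-!
# [EtTh] Def. 3.6 (i)/(ii)(b): the constant line and integrality at the constructed data of monoid types
# `ℚ` and `ℝ` (`RealifiedDivisorMonoids.ofRlfQ`, `ofRlfR`) — and the bracketed sentence of Def. 3.6 (ii)(b)
# there; at `Λ = ℝ` with NO Prop. 3.4 input

S. Mochizuki, *The étale theta function …*, Publ. RIMS **45** (2009) [EtTh], §3: Def. 3.3 (iii) PDF p.73,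
Prop. 3.4 (ii) p.74, Def. 3.6 (i)–(ii) pp.76–77 of `paper:doi-10-2977-prims-1234361159`
[cite: MochizukiEtTh2009, Def 3.6 p.76] [cite: MochizukiEtTh2009, Def 3.6 p.77]:

> (Def. 3.6 (i)) "`B₀^Λ ⊆ (Φ₀^ℝ)^gp` for the monoid `B₀` (respectively, `B₀^pf`; `ℝ·Φ₀^birat ⊆ (Φ₀^ℝ)^gp`);
> `F₀^Λ ⊆ B₀^Λ` for the submonoid … `F₀` (respectively, `F₀^pf`; `ℝ·Φ₀^cnst`) if `Λ = ℤ` (respectively,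
> `Λ = ℚ`; `Λ = ℝ`)."

abc-iut cell, layer L2, seat abc-iut-w4-d008 (gen 3); proof-only sequel (0 defs) of
`Discharge/Sec3ConstantLineOfRlfZ.lean` (same seat).  The three constructors of the Def. 3.6 (i) data from the
Def. 3.3 (iii) data `dm` — `ofRlfZ` (abc-iut-L6-t12), `ofRlfQ` (abc-iut-w5-d130), `ofRlfR` (abc-iut-w4-d084) —
SHARE `Φ₀^ℝ := Φ₀^rlf` and `ℝ·Φ₀^cnst :=` the `ℝ`-span of `Φ₀^cnst` (definitionally: `ofRlfR_cnstR`), so the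
binders `hLine`/`hInt` of `Discharge/Sec3Def36NonzeroConstants.lean` (GAP rows G-w5d124-2, G-w5d250-1)
evaluate at `Λ = ℚ, ℝ` exactly as at `Λ = ℤ`:

* `ofRlfQ_isCancelMul`, `ofRlfR_isCancelMul` — `hInt`, NO hypothesis;
* `ofRlfQ_line`, `ofRlfR_line` — `hLine` from the ONE `B₀`-level binder
  `hcyc : ∀ Y, ∃ d ∈ Φ₀(Y), ∀ b ∈ F₀(Y), ∃ n : ℤ, div₀(b) = dⁿ` (Prop. 3.4 (ii): `div₀(c) = v_L(c)·div(ϖ_L)`).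

The third input of the derivation of the bracketed sentence of Def. 3.6 (ii)(b) (`hNZ`) differs by type:
* `Λ = ℚ`: `hP34Λ` = abc-iut-w4-d084's `Prop34Cnst.ofRlfQ_mem_FΛ_of_divΛ_eq_of'` (p427133) from `dm.Prop34` ⇒
  **`TemperedFrobenioid.exists_cnstFn_effective_ofRlfQ`** modulo `dm.Prop34` + `hcyc`;
* `Λ = ℝ`: `hP34Λ` FAILS at `ofRlfR` as constructed (abc-iut-w4-d084's kernel countermodel, GAP row G-w5d130-1:
  `F₀^ℝ = ℝ·Φ₀^cnst` need not contain a function of effective divisor), but the ALTERNATIVE third input of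
  `exists_cnstFn_effective_of_line_of_inv` holds trivially: `F₀^ℝ(Y) = B₀^ℝ(Y) ∩ ℝ·Φ₀^cnst(Y)` is a GROUP
  (abc-iut-w5-d135's `RealifiedDivisorMonoids.ofRlfR_hFinv`, `Discharge/Sec3FLambdaInvOfRlf.lean`, consumed BY
  NAME) ⇒ **`TemperedFrobenioid.exists_cnstFn_effective_ofRlfR`** modulo `hcyc` ALONE — no Prop. 3.4 input.
* The same alternative at `Λ = ℤ, ℚ`: `exists_cnstFn_effective_ofRlfZ_of_inv` / `…_ofRlfQ_of_inv` from `hcyc` +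
  the `B₀`-level inverse-closure `hF₀inv` of `F₀` ("`F₀(Y) ≅ L^×` is a group", Prop. 3.4 (ii) third iso;
  `ofRlfZ_hFinv_iff` / `ofRlfQ_hFinv_of'` of the same file) instead of `dm.Prop34`.
Row C38-L05 there: at `Λ = ℚ` it is `bsFldPreStepLimitCriterion_of_line hF (Prop34Cnst.ofRlfQ_mem_FΛ_of_divΛ_eq_of'
h34) (ofRlfQ_line dm hpf hcyc) (ofRlfQ_isCancelMul dm hpf) hSup` (one line; not restated — it would duplicate the
`ofRlfZ` corollary up to the data); at `Λ = ℝ` the criterion's own `hP34Λ` binder (used a second time inside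
abc-iut-w5-d124's part (d), for the line of `O^▷`-divisors) stays — `bsFldPreStepLimitCriterion_ofRlfR` modulo
`hP34Λ`, `hcyc`, `hSup`.
HONEST FRAMING: refereed pre-IUT material ([EtTh] §3 over [FrdI] §2); nothing here bears on [IUTchIII]
Cor. 3.12; no statement of the paper is strengthened; typed ≠ proved for the rest of §3.
-/

noncomputable section

namespace Literature.AnabelianGeometry.EtaleTheta

open CategoryTheory Opposite Literature.AlgebraicGeometry.Frobenioids

universe u₀ v₀ u v w

namespace RealifiedDivisorMonoids

variable {D₀ : Type u} [Category.{v} D₀] (dm : DivisorMonoids.{u, v, w} D₀)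
  (hpf : ∀ Y : D₀ᵒᵖ, IsPerfFactorial (dm.Φ₀.obj Y))

/-! ### Monoid type `ℚ` -/

/-- `Φ₀^ℝ(Y) = Φ₀(Y)^rlf` of `ofRlfQ dm hpf` is integral (`hInt`, no hypothesis).
[cite: MochizukiFrdI2008, Def. 2.4 (i) p.48] -/
theorem ofRlfQ_isCancelMul (Y : D₀ᵒᵖ) : IsCancelMul ((ofRlfQ dm hpf).ΦR.obj Y) :=
  IsPerfFactorial.Rlf.isCancelMul (hpf Y)

/-- **`hLine` at `ofRlfQ dm hpf`** (its `ℝ·Φ₀^cnst` is that of `ofRlfZ`): from `hcyc`.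
[cite: MochizukiEtTh2009, Def 3.6 p.76] -/
theorem ofRlfQ_line
    (hcyc : ∀ Y : D₀ᵒᵖ, ∃ d : dm.Φ₀.obj Y, ∀ b ∈ dm.F₀ Y, ∃ n : ℤ,
      dm.div₀ Y b = Algebra.GrothendieckGroup.of d ^ n) :
    ∀ (Y : D₀ᵒᵖ) (g : Algebra.GrothendieckGroup ((ofRlfQ dm hpf).ΦR.obj Y)), g ∈ (ofRlfQ dm hpf).cnstR Y →
      ∃ r : (ofRlfQ dm hpf).ΦR.obj Y,
        g = Algebra.GrothendieckGroup.of r ∨ g = (Algebra.GrothendieckGroup.of r)⁻¹ :=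
  ofRlfZ_line dm hpf hcyc

/-! ### Monoid type `ℝ` -/

/-- `Φ₀^ℝ(Y) = Φ₀(Y)^rlf` of `ofRlfR dm hpf` is integral (`hInt`, no hypothesis).
[cite: MochizukiFrdI2008, Def. 2.4 (i) p.48] -/
theorem ofRlfR_isCancelMul (Y : D₀ᵒᵖ) : IsCancelMul ((ofRlfR dm hpf).ΦR.obj Y) :=
  IsPerfFactorial.Rlf.isCancelMul (hpf Y)

/-- **`hLine` at `ofRlfR dm hpf`** (its `ℝ·Φ₀^cnst` is that of `ofRlfZ`, `ofRlfR_cnstR`): from `hcyc`.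
[cite: MochizukiEtTh2009, Def 3.6 p.76] -/
theorem ofRlfR_line
    (hcyc : ∀ Y : D₀ᵒᵖ, ∃ d : dm.Φ₀.obj Y, ∀ b ∈ dm.F₀ Y, ∃ n : ℤ,
      dm.div₀ Y b = Algebra.GrothendieckGroup.of d ^ n) :
    ∀ (Y : D₀ᵒᵖ) (g : Algebra.GrothendieckGroup ((ofRlfR dm hpf).ΦR.obj Y)), g ∈ (ofRlfR dm hpf).cnstR Y →
      ∃ r : (ofRlfR dm hpf).ΦR.obj Y,
        g = Algebra.GrothendieckGroup.of r ∨ g = (Algebra.GrothendieckGroup.of r)⁻¹ :=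
  ofRlfZ_line dm hpf hcyc

end RealifiedDivisorMonoids

/-! ### Def. 3.6 (ii)(b), bracketed sentence, and row C38-L05 over `ofRlfQ` / `ofRlfR` -/

namespace TemperedFrobenioid

variable {D₀ : Type u} [Category.{v} D₀] {dm : DivisorMonoids.{u, v, w} D₀}
  {hpf : ∀ Y : D₀ᵒᵖ, IsPerfFactorial (dm.Φ₀.obj Y)} {V : FrdIMonoidStub.{w}} {V₀ : FrdICatStub.{u, v, w} D₀}
  {D : Type u₀} [Category.{v₀} D] {VD : FrdICatStub.{u₀, v₀, w} D}

section Z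

variable (C₀ : TemperedFrobenioid (RealifiedDivisorMonoids.ofRlfZ dm hpf) D VD)

/-- **Def. 3.6 (ii)(b), bracketed sentence, over `ofRlfZ dm hpf` — variant without Prop. 3.4**: from `hcyc` and the
`B₀`-level inverse-closure `hF₀inv` of `F₀` ("`F₀(Y) ≅ L^×`", Prop. 3.4 (ii) third iso; = `hFinv` at `ofRlfZ` by
`ofRlfZ_hFinv_iff`). [cite: MochizukiEtTh2009, Def 3.6 p.77] -/
theorem exists_cnstFn_effective_ofRlfZ_of_inv
    (hF₀inv : ∀ (Y : D₀ᵒᵖ) (b : dm.B₀.obj Y), b ∈ dm.F₀ Y → ∃ b' ∈ dm.F₀ Y, b' * b = 1)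
    (hcyc : ∀ Y : D₀ᵒᵖ, ∃ d : dm.Φ₀.obj Y, ∀ b ∈ dm.F₀ Y, ∃ n : ℤ,
      dm.div₀ Y b = Algebra.GrothendieckGroup.of d ^ n)
    (A : Dᵒᵖ) :
    ∃ u : ((RealifiedDivisorMonoids.ofRlfZ dm hpf).BΛ.obj (C₀.baseOp A) : Type w) ×
        Algebra.GrothendieckGroup (C₀.Φ.carrier A),
      u ∈ C₀.cnstFn A ∧ ∃ Z : C₀.Φ.carrier A, Z ≠ 1 ∧ u.2 = Algebra.GrothendieckGroup.of Z :=
  C₀.exists_cnstFn_effective_of_line_of_inv (RealifiedDivisorMonoids.ofRlfZ_line dm hpf hcyc)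
    (RealifiedDivisorMonoids.ofRlfZ_isCancelMul dm hpf)
    ((RealifiedDivisorMonoids.ofRlfZ_hFinv_iff dm hpf).2 hF₀inv) A

end Z

section Q

variable (C₀ : TemperedFrobenioid (RealifiedDivisorMonoids.ofRlfQ dm hpf) D VD)

/-- **Def. 3.6 (ii)(b), bracketed sentence, for every tempered Frobenioid over the constructed data of monoid
type `ℚ`** (`hNZ` of row C38-L05 VERBATIM), modulo `dm.Prop34` + `hcyc` (statements about the Def. 3.3 (iii)
data only). [cite: MochizukiEtTh2009, Def 3.6 p.77] -/
theorem exists_cnstFn_effective_ofRlfQ (h34 : dm.Prop34 V V₀)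
    (hcyc : ∀ Y : D₀ᵒᵖ, ∃ d : dm.Φ₀.obj Y, ∀ b ∈ dm.F₀ Y, ∃ n : ℤ,
      dm.div₀ Y b = Algebra.GrothendieckGroup.of d ^ n)
    (A : Dᵒᵖ) :
    ∃ u : ((RealifiedDivisorMonoids.ofRlfQ dm hpf).BΛ.obj (C₀.baseOp A) : Type w) ×
        Algebra.GrothendieckGroup (C₀.Φ.carrier A),
      u ∈ C₀.cnstFn A ∧ ∃ Z : C₀.Φ.carrier A, Z ≠ 1 ∧ u.2 = Algebra.GrothendieckGroup.of Z :=
  C₀.exists_cnstFn_effective_of_line (RealifiedDivisorMonoids.ofRlfQ_line dm hpf hcyc)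
    (RealifiedDivisorMonoids.ofRlfQ_isCancelMul dm hpf)
    (RealifiedDivisorMonoids.Prop34Cnst.ofRlfQ_mem_FΛ_of_divΛ_eq_of' h34) A

/-- **Def. 3.6 (ii)(b), bracketed sentence, over `ofRlfQ dm hpf` — variant without Prop. 3.4**: from `hcyc` and the
`B₀`-level inverse-closure `hF₀inv` of `F₀` (its perfection `F₀^pf = F₀^ℚ` is then inverse-closed,
`ofRlfQ_hFinv_of'`). [cite: MochizukiEtTh2009, Def 3.6 p.77] -/
theorem exists_cnstFn_effective_ofRlfQ_of_inv
    (hF₀inv : ∀ (Y : D₀ᵒᵖ) (b : dm.B₀.obj Y), b ∈ dm.F₀ Y → ∃ b' ∈ dm.F₀ Y, b' * b = 1)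
    (hcyc : ∀ Y : D₀ᵒᵖ, ∃ d : dm.Φ₀.obj Y, ∀ b ∈ dm.F₀ Y, ∃ n : ℤ,
      dm.div₀ Y b = Algebra.GrothendieckGroup.of d ^ n)
    (A : Dᵒᵖ) :
    ∃ u : ((RealifiedDivisorMonoids.ofRlfQ dm hpf).BΛ.obj (C₀.baseOp A) : Type w) ×
        Algebra.GrothendieckGroup (C₀.Φ.carrier A),
      u ∈ C₀.cnstFn A ∧ ∃ Z : C₀.Φ.carrier A, Z ≠ 1 ∧ u.2 = Algebra.GrothendieckGroup.of Z :=
  C₀.exists_cnstFn_effective_of_line_of_inv (RealifiedDivisorMonoids.ofRlfQ_line dm hpf hcyc)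
    (RealifiedDivisorMonoids.ofRlfQ_isCancelMul dm hpf)
    (RealifiedDivisorMonoids.ofRlfQ_hFinv_of' dm hpf hF₀inv) A

end Q

section R

variable (C₀ : TemperedFrobenioid (RealifiedDivisorMonoids.ofRlfR dm hpf) D VD)

/-- **Def. 3.6 (ii)(b), bracketed sentence, for every tempered Frobenioid over the constructed data of monoid
type `ℝ`** (`hNZ` of row C38-L05 VERBATIM), modulo `hcyc` ALONE — no Prop. 3.4 input: the third input is the
inverse-closure of `F₀^ℝ`, which holds by construction (abc-iut-w5-d135's `ofRlfR_hFinv`).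
[cite: MochizukiEtTh2009, Def 3.6 p.77] -/
theorem exists_cnstFn_effective_ofRlfR
    (hcyc : ∀ Y : D₀ᵒᵖ, ∃ d : dm.Φ₀.obj Y, ∀ b ∈ dm.F₀ Y, ∃ n : ℤ,
      dm.div₀ Y b = Algebra.GrothendieckGroup.of d ^ n)
    (A : Dᵒᵖ) :
    ∃ u : ((RealifiedDivisorMonoids.ofRlfR dm hpf).BΛ.obj (C₀.baseOp A) : Type w) ×
        Algebra.GrothendieckGroup (C₀.Φ.carrier A),
      u ∈ C₀.cnstFn A ∧ ∃ Z : C₀.Φ.carrier A, Z ≠ 1 ∧ u.2 = Algebra.GrothendieckGroup.of Z :=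
  C₀.exists_cnstFn_effective_of_line_of_inv (RealifiedDivisorMonoids.ofRlfR_line dm hpf hcyc)
    (RealifiedDivisorMonoids.ofRlfR_isCancelMul dm hpf)
    (RealifiedDivisorMonoids.ofRlfR_hFinv dm hpf) A

/-- **Row C38-L05 over `ofRlfR dm hpf`**: `hNZ` supplied from `hcyc`; the criterion's own `hP34Λ` binder (the line
of `O^▷`-divisors in abc-iut-w5-d124's part (d)) and `hSup` stay. [cite: MochizukiEtTh2009, Cor 3.8 p.81] -/
theorem bsFldPreStepLimitCriterion_ofRlfR (hF : PreFrobenioid.IsFrobenioid C₀.toElem)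
    (hP34Λ : ∀ (Y : D₀ᵒᵖ) (b : (RealifiedDivisorMonoids.ofRlfR dm hpf).BΛ.obj Y)
      (r : (RealifiedDivisorMonoids.ofRlfR dm hpf).ΦR.obj Y),
      (RealifiedDivisorMonoids.ofRlfR dm hpf).divΛ Y b = Algebra.GrothendieckGroup.of r →
        b ∈ (RealifiedDivisorMonoids.ofRlfR dm hpf).FΛ Y)
    (hcyc : ∀ Y : D₀ᵒᵖ, ∃ d : dm.Φ₀.obj Y, ∀ b ∈ dm.F₀ Y, ∃ n : ℤ,
      dm.div₀ Y b = Algebra.GrothendieckGroup.of d ^ n)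
    (hSup : ∀ (W : D) (m : Perfection (C₀.divisorMonoid.obj (op W)))
      (U : Set (Perfection (C₀.divisorMonoid.obj (op W)))),
      U ⊆ C₀.bsFldPf W → U.Nonempty → (∀ u ∈ U, u ∣ m) → ∃ y ∈ C₀.bsFldPf W, (∀ u ∈ U, u ∣ y) ∧ y ∣ m) :
    C₀.BsFldPreStepLimitCriterion (PreFrobenioidData.perfection hF) :=
  C₀.bsFldPreStepLimitCriterion_of hF hP34Λ (C₀.exists_cnstFn_effective_ofRlfR hcyc) hSup

end R

end TemperedFrobenioid

end Literature.AnabelianGeometry.EtaleTheta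

end
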